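import Summits.QuantumAdvantage.QuantumAdvantage.Theses.SpinorFlattening
import Summits.QuantumAdvantage.QuantumAdvantage.Theorems.SpinorFlatteningNegApproxGaussRankSuperpoly
import Summits.QuantumAdvantage.QuantumAdvantage.Theorems.GaussRankPolyImpliesPPoly.Negative.RefutationShape

/-!
# Refutation of the TARGET `SpinorFlattening.GaussRankPolyThesis` (stmt-QuantumAdvantage-1244)

The route's designed outcome: the kill item `NegApproxGaussRankSuperpoly` (stmt-1245) is a theorem
(`SpinorFlattening.NegApproxGaussRankSuperpoly_of`, landed 2026-08-16: Bessel mass bound + CAR normal-ordering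
deficiency + flat orthonormality + binomial count ⇒ at `δ = 1/2` every `≤ t^c + c`-term Gaussian
combination stays at squared distance `> 1/4` from `|M⟩^{⊗t}` for some `t`), and it contradicts the thesis
`X` = polynomial `δ`-approximate Gaussian rank for EVERY `δ > 0`
(`GaussRankPolyImpliesPPoly.Negative.GaussRankPolyThesis_false_of_negApprox`, landed p73188).
-/

set_option linter.dupNamespace false

namespace Summit.QuantumAdvantage.QuantumAdvantage.Theorems

open Summit.QuantumAdvantage.QuantumAdvantage.Theses.SpinorFlattening

/-- Refutes `SpinorFlattening.GaussRankPolyThesis` [refuted-substantive]: the matchgate-magic powers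
`|M⟩^{⊗t}` do NOT have polynomial `δ`-approximate fermionic Gaussian rank for every `δ > 0` — at `δ = 1/2`
the rank is superpolynomial in `t` (kill item `NegApproxGaussRankSuperpoly`, proved in-tree by the
spectral-mass-flattening line: `‖M^{⊗t} − φ‖² ≥ 1 − r·D_K(4t)/(C(t,K)8^K)` for every `r`-term Gaussian
combination `φ`, and `2(t^c+c)·D_K(4t) < C(t,K)8^K` for suitable `t, K`). Witness: the `δ = 1/2`, every-`c`
counterexample family supplied by `NegApproxGaussRankSuperpoly_of`. No cheap repair: the load-bearing claim
(polynomial constant-precision Gaussian rank) is false at every constant `δ < 1` by the same mass bound;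
only `t`-DEPENDENT term budgets `2^{Θ(t)}` survive. barrier-candidate: "secant-flattening mass bounds give
exponential constant-precision rank lower bounds for tensor powers of Gaussian-fidelity-`< 1` factors on the
free-fermion island". [folklore] -/
theorem SpinorFlatteningGaussRankPolyThesis_refuted : ¬ GaussRankPolyThesis :=
  GaussRankPolyImpliesPPoly.Negative.GaussRankPolyThesis_false_of_negApprox
    SpinorFlattening.NegApproxGaussRankSuperpoly_of

end Summit.QuantumAdvantage.QuantumAdvantage.Theorems
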